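import Summits.Parity.BatemanHorn.Theses.AlmostPrimeZeros
import Summits.Parity.BatemanHorn.Theorems.DiscMajorantLog.Negative.FalseWithoutPairwise
import Summits.Parity.BatemanHorn.Theorems.BalancedSemiprimeLayer.Negative.TightAtX

/-!
# Crux `DiscMajorantLog` (stmt-Parity-17114), line `Sketch`, stub `stub_leftHalfTwinViolation`

Barrier lemma for the `Re z = 0` cut of the lead's skeleton
(`Summit.Parity.BatemanHorn.Cruxes.DiscMajorantLog.Sketch`): the LEFT half-disc majorant (`Re z < 0`)
asked of the Selberg parity twin `E_x(z) = S_x(z) + S_x(−z)` instead of `S_x(z) = Σ_{n ≤ x} z^{s_f(n)}`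
is FALSE.  Witness: `k = 1`, `f = (X)`, `z = −1` (inside the disc `‖z − 1‖ ≤ 3 log log x` once
`x ≥ 16`), where `−z = 1` and

  `E_x(−1) = Σ_{n ≤ x} ((−1)^{s(n)} + 1) = 2 · #{n ≤ x : s(n) even}`,  `s(n) = Σ_{p^v ∥ n} min(v, 2)`.

Since `s(2m) = s(m) + 1` for odd `m`, exactly one of `m`, `2m` has even statistic, so
`t ↦ (2t+1 or 2(2t+1))` injects `{t < ⌊x/4⌋}` into `{n ≤ x : s(n) even}`: the twin sum is `≥ 2⌊x/4⌋`,
while the claimed budget at `z = −1`, `k = 1` is `A x (log x)^{−2} e^{2C log 4} = o(x)`; choosing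
`log x ≥ |A e^{2C log 4}| + 4` gives the contradiction.  (Bookkeeping adapted from
`Theorems/DiscMajorantLog/Negative/StrengtheningsRefuted.lean`, `budget_false_of_eq_at_neg_one`.)
-/

noncomputable section

namespace Summit.Parity.BatemanHorn.Cruxes.DiscMajorantLog.Sketch

open Polynomial
open Literature.NumberTheory.Sieve
open Summit.Parity.BatemanHorn.Theorems.DiscMajorantLog.Negative (two_le_three_loglog_of_sixteen_le)
open Summit.Parity.BatemanHorn.Theorems.BalancedSemiprimeLayer.Negative (isBatemanHornSystem_X)

namespace LeftHalfTwinViolation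

/-- `s(2m) = s(m) + 1` for odd `m`: the factorization of `2m` is `single 2 1 + factorization m` on
disjoint supports, and the new prime `2` contributes `min(1, 2) = 1` to the capped statistic. [folklore] -/
theorem capped_two_mul_of_odd {m : ℕ} (hm : Odd m) :
    ((2 * m).factorization.sum fun _ v => min v 2) = (m.factorization.sum fun _ v => min v 2) + 1 := by
  have hm0 : m ≠ 0 := by
    rintro rfl
    exact Nat.not_odd_zero hm
  have h2 : ¬ 2 ∣ m := by
    rintro ⟨c, rfl⟩
    obtain ⟨d, hd⟩ := hm
    omega
  have hd : Disjoint (Finsupp.single 2 1 : ℕ →₀ ℕ).support m.factorization.support := by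
    rw [Finsupp.support_single 2 one_ne_zero, Nat.support_factorization,
      Finset.disjoint_singleton_left, Nat.mem_primeFactors]
    exact fun h => h2 h.2.1
  rw [Nat.factorization_mul two_ne_zero hm0, Nat.prime_two.factorization,
    Finsupp.sum_add_index_of_disjoint hd, Finsupp.sum_single_index, add_comm]
  · rfl
  · rfl

/-- Parity transfer: for odd `m` with `s(m)` odd, `s(2m) = s(m) + 1` is even. [folklore] -/
theorem even_capped_two_mul_of_odd {m : ℕ} (hm : Odd m)
    (h : ¬ Even (m.factorization.sum fun _ v => min v 2)) :
    Even ((2 * m).factorization.sum fun _ v => min v 2) := by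
  rw [capped_two_mul_of_odd hm, Nat.even_add_one]
  exact h

/-- Counting: at least `⌊x/4⌋` of the `0 ≤ n ≤ x` have even capped statistic, via the injection
`t ↦ 2t+1` if `s(2t+1)` is even, `t ↦ 2(2t+1)` otherwise (`t < ⌊x/4⌋`, so both are `≤ x`). [folklore] -/
theorem div_four_le_card_even (x : ℕ) :
    x / 4 ≤ ((Finset.range (x + 1)).filter fun n => Even (n.factorization.sum fun _ v => min v 2)).card := by
  calc x / 4 = (Finset.range (x / 4)).card := (Finset.card_range _).symm
    _ ≤ _ := Finset.card_le_card_of_injOn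
        (fun t => if Even ((2 * t + 1).factorization.sum fun _ v => min v 2) then 2 * t + 1
          else 2 * (2 * t + 1)) ?_ ?_
  · intro t ht
    have ht' : t < x / 4 := by simpa using ht
    simp only [Finset.coe_filter, Finset.mem_range, Set.mem_setOf_eq]
    split_ifs with hev
    · exact ⟨by omega, hev⟩
    · exact ⟨by omega, even_capped_two_mul_of_odd (odd_two_mul_add_one t) hev⟩
  · intro t₁ _ t₂ _ h
    simp only at h
    split_ifs at h <;> omega

end LeftHalfTwinViolation

open LeftHalfTwinViolation

/-- **Barrier: the left half-disc majorant is VIOLATED by the parity twin.**  If one asks the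
left-half bound (`Re z < 0`) not of `S_x(z) = Σ_{n ≤ x} z^{s_f(n)}` but of the Selberg twin
`E_x(z) = S_x(z) + S_x(−z)` (generating polynomial of `a_n = 1 + (−1)^{s_f(n)}`, indistinguishable from
`S_x` by sieve-theoretic inputs), it is FALSE: for `k = 1`, `f = (X)`, at `z = −1` (inside the disc once
`x ≥ 16`), `E_x(−1) = 2·#{n ≤ x : s(n) even} ≥ 2⌊x/4⌋` (of `m` odd and `2m` exactly one has even `s`),
against the claimed `A x (log x)^{−2} e^{2C log 4} = o(x)`. [folklore] -/
theorem stub_leftHalfTwinViolation :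
    ¬ ∀ (k : ℕ) (f : Fin k → Polynomial ℤ), Literature.NumberTheory.Sieve.IsBatemanHornSystem f →
      ∃ A C : ℝ, ∃ x₀ : ℕ, ∀ x : ℕ, x₀ ≤ x → ∀ z : ℂ, ‖z - 1‖ ≤ 3 * Real.log (Real.log (x : ℝ)) →
        z.re < 0 →
        ‖(∑ n ∈ Finset.range (x + 1), (z : ℂ) ^ (∑ i, (((f i).eval (n : ℤ)).toNat.factorization.sum fun _ v => min v 2))) +
            (∑ n ∈ Finset.range (x + 1), (-z : ℂ) ^ (∑ i, (((f i).eval (n : ℤ)).toNat.factorization.sum fun _ v => min v 2)))‖ ≤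
          A * (x : ℝ) * (Real.log (x : ℝ)) ^ ((k : ℝ) * ((z : ℂ).re - 1)) *
            Real.exp (C * ‖(z : ℂ) - 1‖ * Real.log (‖(z : ℂ) - 1‖ + 2)) := by
  -- adapted from Theorems/DiscMajorantLog/Negative/StrengtheningsRefuted.lean (budget at `z = -1`)
  intro h
  obtain ⟨A, C₀, x₀, h⟩ := h 1 ![(X : ℤ[X])] isBatemanHornSystem_X
  set E : ℝ := Real.exp (C₀ * 2 * Real.log (2 + 2)) with hE
  set K : ℝ := |A * E| with hK
  have hK0 : 0 ≤ K := abs_nonneg _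
  set x : ℕ := max (max x₀ 16) ⌈Real.exp (K + 4)⌉₊ with hxdef
  have hx₀ : x₀ ≤ x := le_trans (le_max_left _ _) (le_max_left _ _)
  have hx16 : (16 : ℝ) ≤ x := by exact_mod_cast le_trans (le_max_right x₀ 16) (le_max_left _ _)
  have hxpos : (0 : ℝ) < x := by linarith
  have hxK : Real.exp (K + 4) ≤ x := le_trans (Nat.le_ceil _) (by exact_mod_cast le_max_right _ _)
  obtain ⟨h23, hlogx⟩ := two_le_three_loglog_of_sixteen_le hx16
  have hlogK : K + 4 ≤ Real.log x := by rw [Real.le_log_iff_exp_le hxpos]; exact hxK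
  have hz : ‖(-1 : ℂ) - 1‖ ≤ 3 * Real.log (Real.log (x : ℝ)) := by
    rw [show (-1 : ℂ) - 1 = -2 by norm_num, norm_neg, Complex.norm_two]; exact h23
  have hre0 : (-1 : ℂ).re < 0 := by norm_num
  have hmain := h x hx₀ (-1) hz hre0
  -- the statistic of the system `(X)` is the capped statistic `s(n)` of `n`
  set e : ℕ → ℕ := fun n => ∑ i : Fin 1,
    ((((![(X : ℤ[X])] : Fin 1 → ℤ[X]) i).eval (n : ℤ)).toNat.factorization.sum fun _ v => min v 2) with he
  have he' : ∀ n : ℕ, e n = n.factorization.sum fun _ v => min v 2 := by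
    intro n
    simp only [he, Fin.sum_univ_one, Matrix.cons_val_fin_one, eval_X, Int.toNat_natCast]
  -- the even-statistic count `N`
  obtain ⟨N, hN⟩ : ∃ N : ℕ,
      N = ((Finset.range (x + 1)).filter fun n => Even (n.factorization.sum fun _ v => min v 2)).card :=
    ⟨_, rfl⟩
  -- the twin sum at `z = -1` is `2N`
  have hsum : (∑ n ∈ Finset.range (x + 1), (-1 : ℂ) ^ (e n)) +
      (∑ n ∈ Finset.range (x + 1), (-(-1) : ℂ) ^ (e n)) = ((2 * N : ℕ) : ℂ) := by
    rw [neg_neg, ← Finset.sum_add_distrib]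
    simp_rw [one_pow, he']
    rw [← Finset.sum_filter_add_sum_filter_not (Finset.range (x + 1))
      (fun n => Even (n.factorization.sum fun _ v => min v 2))]
    have h1 : ∀ n ∈ (Finset.range (x + 1)).filter (fun n => Even (n.factorization.sum fun _ v => min v 2)),
        (-1 : ℂ) ^ (n.factorization.sum fun _ v => min v 2) + 1 = 2 := by
      intro n hn
      rw [(Finset.mem_filter.mp hn).2.neg_one_pow]; norm_num
    have h2 : ∀ n ∈ (Finset.range (x + 1)).filter (fun n => ¬Even (n.factorization.sum fun _ v => min v 2)),
        (-1 : ℂ) ^ (n.factorization.sum fun _ v => min v 2) + 1 = 0 := by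
      intro n hn
      rw [(Nat.not_even_iff_odd.mp (Finset.mem_filter.mp hn).2).neg_one_pow]; norm_num
    rw [Finset.sum_congr rfl h2, Finset.sum_const_zero, add_zero, Finset.sum_congr rfl h1,
      Finset.sum_const, nsmul_eq_mul, ← hN]
    push_cast; ring
  change ‖(∑ n ∈ Finset.range (x + 1), (-1 : ℂ) ^ (e n)) +
      (∑ n ∈ Finset.range (x + 1), (-(-1) : ℂ) ^ (e n))‖ ≤
    A * (x : ℝ) * (Real.log (x : ℝ)) ^ (((1 : ℕ) : ℝ) * ((-1 : ℂ).re - 1)) *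
      Real.exp (C₀ * ‖(-1 : ℂ) - 1‖ * Real.log (‖(-1 : ℂ) - 1‖ + 2)) at hmain
  rw [hsum, Complex.norm_natCast, show (-1 : ℂ) - 1 = -2 by norm_num, norm_neg, Complex.norm_two]
    at hmain
  have hre : ((1 : ℕ) : ℝ) * ((-1 : ℂ).re - 1) = -((2 : ℕ) : ℝ) := by norm_num
  have h2N : ((2 * N : ℕ) : ℝ) = 2 * (N : ℝ) := by push_cast; ring
  rw [hre, Real.rpow_neg hlogx.le, Real.rpow_natCast, h2N] at hmain
  -- counting: `⌊x/4⌋ ≤ N`, `x ≤ 4⌊x/4⌋ + 3`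
  obtain ⟨q, hq⟩ : ∃ q : ℕ, q = x / 4 := ⟨_, rfl⟩
  have hqN : q ≤ N := by rw [hq, hN]; exact div_four_le_card_even x
  have hxq : x ≤ 4 * q + 3 := by omega
  have hqNR : (q : ℝ) ≤ N := by exact_mod_cast hqN
  have hxqR : (x : ℝ) ≤ 4 * (q : ℝ) + 3 := by exact_mod_cast hxq
  have hNR : (x : ℝ) - 3 ≤ 4 * (N : ℝ) := by linarith
  -- the budget: `2N (log x)^2 ≤ K x`
  have hpow : 0 < Real.log (x : ℝ) ^ 2 := pow_pos hlogx 2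
  have h1 : 2 * (N : ℝ) * Real.log (x : ℝ) ^ 2 ≤ K * x := by
    have := mul_le_mul_of_nonneg_right hmain hpow.le
    calc 2 * (N : ℝ) * Real.log (x : ℝ) ^ 2
        ≤ A * x * (Real.log (x : ℝ) ^ 2)⁻¹ * E * Real.log (x : ℝ) ^ 2 := this
      _ = A * E * x := by field_simp
      _ ≤ K * x := mul_le_mul_of_nonneg_right (le_abs_self _) hxpos.le
  -- `(log x)^2 ≥ 4(K + 4)` and the contradiction `32 N ≤ 0 < x - 3 ≤ 4N`
  have hL4 : (4 : ℝ) ≤ Real.log x := by linarith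
  have hL2 : (K + 4) * 4 ≤ Real.log (x : ℝ) ^ 2 := by
    rw [sq]; exact mul_le_mul hlogK hL4 (by norm_num) hlogx.le
  have hB : 2 * (N : ℝ) * ((K + 4) * 4) ≤ 2 * (N : ℝ) * Real.log (x : ℝ) ^ 2 :=
    mul_le_mul_of_nonneg_left hL2 (by positivity)
  have hC : K * ((x : ℝ) - 3) ≤ K * (4 * (N : ℝ)) := mul_le_mul_of_nonneg_left hNR hK0
  have hD : K * 6 ≤ K * (x : ℝ) := mul_le_mul_of_nonneg_left (by linarith) hK0
  nlinarith

end Summit.Parity.BatemanHorn.Cruxes.DiscMajorantLog.Sketch
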